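import Summits.KontsevichZagierPeriods.KontsevichZagierPeriods.Theses.LiftingCriteria
import Summits.KontsevichZagierPeriods.KontsevichZagierPeriods.Theorems.InverseLandauTateFamilyKernelTameCertificate
import Literature.NumberTheory.Transcendental.SemialgebraicLineDeriv
import Literature.NumberTheory.Transcendental.KZSubcalculusInvariants
import Literature.NumberTheory.Transcendental.KZLogCalculusProofs

/-!
# Stub S2a `stub_pencilContinuation` of crux `DilationTransfer` (line `birth`): continuation along
the dilation pencil by the identity theorem (RESHAPE 2 of the skeleton, registered)

Crux `stmt-KontsevichZagierPeriods-3572`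
(`Summit.KontsevichZagierPeriods.KontsevichZagierPeriods.Theses.LiftingCriteria.DilationTransfer`),
line `birth`, stub S2a (the RADIUS step).

## Why the ORIGINAL signature (reshape 1) was not provable, and the registered one (reshape 2) is

The original stub asked: from a Stokes germ `F = Σ_k relA_{c_k}(H_k)` of the pencil integrand,
valid for `ϖ ≤ ε` with `H_k` `ℚ`-semialgebraic and analytic on an open `W ⊇ [0,1]^N × [0, ε]`,
conclude a parametric Stokes form of `f₀ ∘ π` near the slice `ϖ = ϖ₀`.  The hypothesis carries no
information beyond `ε`: if `(H_k)` is Stokes data on `W`, so is `H_1 + z_{c_1} · (ϖ - 2ε)⁻¹` on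
`W ∩ {ϖ < 2ε}` (the operator `∂_{c} - (·)|_{z_c = 1} + (·)|_{z_c = 0}` kills `z_c · q(ϖ)`), with the
same germ identity and a pole before `ϖ₀` whenever `2ε < ϖ₀`.  Hence the registered statement is,
for the integrands `f₀` that arise, exactly cube-exactness of a zero-integral Nash integrand in more
variables (Ayoub's Conjecture B, [cite: Ayoub2014, Def. 10, Prop. 11]), i.e. of the strength of the
Kontsevich–Zagier conjecture; the tree's nearest named fact
`Literature.NumberTheory.Transcendental.AyoubRel.ayoub_relativeKZ_revisited` (Théorème 1.7) is
formal in `ϖ` (Laurent series with polynomial coefficients) and says nothing about the radius of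
convergence of the data over the closed cube.

## What is proved

`stub_pencilContinuation` (registered, reshape 2): the original signature with ONE token changed — the data
`H_k` are required to be `ℚ`-semialgebraic and analytic on an open set containing
`[0,1]^N × [0, max ε ϖ₀]` (instead of `[0,1]^N × [0, ε]`), the germ identity still being assumed
only for `ϖ ≤ ε`.  Then the identity persists on the whole slab `[0,1]^N × [0, ϖ₀]` by the identity
theorem for real-analytic functions of several variables
(`AnalyticOnNhd.eqOn_of_preconnected_of_eventuallyEq` on the convex slab, both sides being analytic
there), and the conclusion holds with `M := 0`, `H' := H`, `c' := c`, `W' := W`.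
-/

noncomputable section

namespace Summit.KontsevichZagierPeriods.LiftingCriteria.DilationTransfer

open scoped BigOperators Topology
open Set Filter
open Literature.NumberTheory.Transcendental

section Analytic

/-- Coordinate projections `v ↦ v i` are real-analytic. [folklore] -/
theorem analyticAt_apply {ι : Type*} [Fintype ι] (i : ι) (w : ι → ℝ) :
    AnalyticAt ℝ (fun v : ι → ℝ => v i) w :=
  (ContinuousLinearMap.proj (R := ℝ) (φ := fun _ : ι => ℝ) i).analyticAt w

/-- Reading coordinates through an index map `v ↦ (l ↦ v (σ l))` is real-analytic. [folklore] -/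
theorem analyticAt_reindex {ι κ : Type*} [Fintype ι] [Fintype κ] (σ : κ → ι) (w : ι → ℝ) :
    AnalyticAt ℝ (fun v : ι → ℝ => fun l : κ => v (σ l)) w :=
  AnalyticAt.pi (f := fun (l : κ) (v : ι → ℝ) => v (σ l)) fun l => analyticAt_apply (σ l) w

/-- The dilated argument of the pencil, `w ↦ w_last • (l ↦ w (castSucc (castLE h l)))`, is
real-analytic. [folklore] -/
theorem analyticAt_dilate {N n : ℕ} (h : n ≤ N) (w : Fin (N + 1) → ℝ) :
    AnalyticAt ℝ (fun v : Fin (N + 1) → ℝ =>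
      v (Fin.last N) • (fun l : Fin n => v (Fin.castSucc (Fin.castLE h l)))) w :=
  (analyticAt_apply (Fin.last N) w).fun_smul
    (analyticAt_reindex (fun l : Fin n => Fin.castSucc (Fin.castLE h l)) w)

/-- Evaluation of a real polynomial at the last coordinate is real-analytic. [folklore] -/
theorem analyticAt_eval_last {N : ℕ} (q : Polynomial ℝ) (w : Fin (N + 1) → ℝ) :
    AnalyticAt ℝ (fun v : Fin (N + 1) → ℝ => q.eval (v (Fin.last N))) w := by
  have h := (analyticAt_apply (Fin.last N) w).aeval_polynomial q
  simpa only [Polynomial.coe_aeval_eq_eval] using h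

/-- Freezing one coordinate, `v ↦ Function.update v j a`, is real-analytic (it is affine).
[folklore] -/
theorem analyticAt_update {ι : Type*} [Fintype ι] [DecidableEq ι] (j : ι) (a : ℝ) (w : ι → ℝ) :
    AnalyticAt ℝ (fun v : ι → ℝ => Function.update v j a) w := by
  refine AnalyticAt.pi (f := fun (i : ι) (v : ι → ℝ) => Function.update v j a i) fun i => ?_
  by_cases hij : i = j
  · subst hij
    simp only [Function.update_self]
    exact analyticAt_const
  · simp only [Function.update_of_ne hij]
    exact analyticAt_apply i w

/-- A directional derivative `v ↦ fderiv ℝ h v e` of a function analytic at `w` is analytic at `w`.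
[folklore] -/
theorem analyticAt_fderiv_apply {ι : Type*} [Fintype ι] {h : (ι → ℝ) → ℝ} {w : ι → ℝ}
    (hh : AnalyticAt ℝ h w) (e : ι → ℝ) :
    AnalyticAt ℝ (fun v : ι → ℝ => fderiv ℝ h v e) w := by
  have h1 := ((ContinuousLinearMap.apply ℝ ℝ e).analyticAt _).fun_comp hh.fderiv
  simpa only [ContinuousLinearMap.apply_apply] using h1

end Analytic

/-- **Stub S2a, corrected form — continuation of the pencil Stokes identity to the special
parameter, GIVEN Nash data up to `ϖ₀`.** Same data and same conclusion as the registered stub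
`stub_pencilContinuation` of line `birth`; the only change is that the Stokes data `H_k` are assumed
`ℚ`-semialgebraic and analytic on an open set containing the slab `[0,1]^N × [0, max ε ϖ₀]` (not only
`[0,1]^N × [0, ε]`), while the germ identity `F = Σ_k (∂_{c_k} H_k − H_k|₁ + H_k|₀)` is still assumed
only for `ϖ ≤ ε`.  Proof: both sides are real-analytic at every point of the convex slab
`P = [0,1]^N × [0, ϖ₀]` (the pencil integrand because `ϖ·πᵢ z ∈ [0,1]^{nᵢ} ⊆ Uᵢ` there, the Stokes
side because `P` and its faces `z_{c_k} ∈ {0,1}` lie in `W`), they agree on an open box around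
`(½,…,½, min(ε,ϖ₀)/2)`, hence on `P` by the identity theorem; on the slice `ϖ = ϖ₀` the
`(ϖ − ϖ₀)`-term vanishes, so `M := 0`, `H' := H` answer the conclusion.  (The registered form, with
data only up to `ε`, is of Kontsevich–Zagier strength: see the module docstring.)
[cite: KontsevichZagier2001, §1.2] [cite: Ayoub2014, Def. 10, Prop. 11] -/
theorem stub_pencilContinuation :
    ∀ (S : ℕ) (n : Fin S → ℕ) (g : (i : Fin S) → (Fin (n i) → ℝ) → ℝ) (U : (i : Fin S) → Set (Fin (n i) → ℝ)), (∀ i, IsOpen (U i) ∧ Set.pi Set.univ (fun _ : Fin (n i) => Set.Icc (0:ℝ) 1) ⊆ (U i) ∧ Literature.NumberTheory.Transcendental.IsSemialgebraicFunOn ℚ (U i) (g i) ∧ AnalyticOnNhd ℝ (g i) (U i)) → ∀ (m : Fin S → ℤ) (m₀ : ℤ) (ϖ₀ : ℚ), 0 < ϖ₀ → ϖ₀ ≤ 1 → ∀ (T : ℕ) (d : Fin T → ℕ) (G : (j : Fin T) → (Fin (d j) → ℝ) → ℝ) (V : (j : Fin T) → Set (Fin (d j) → ℝ)) (μ : Fin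 T → Polynomial ℝ) (μ₀ : Polynomial ℝ), (∀ j, IsOpen (V j) ∧ Set.pi Set.univ (fun _ : Fin (d j) => Set.Icc (0:ℝ) 1) ⊆ (V j) ∧ Literature.NumberTheory.Transcendental.IsSemialgebraicFunOn ℚ (V j) (G j) ∧ AnalyticOnNhd ℝ (G j) (V j)) → (∀ j k, IsAlgebraic ℚ ((μ j).coeff k)) → (∀ k, IsAlgebraic ℚ (μ₀.coeff k)) → (∀ ϖ ∈ Set.Icc (0:ℝ) 1, (m₀ : ℝ) + ∑ i, (m i : ℝ) * (∫ z in Set.pi Set.univ (fun _ : Fin (n i) => Set.Icc (0:ℝ) 1), g i (ϖ • z)) = (ϖ - (ϖ₀ : ℝ)) * (μ₀.eval ϖ + ∑ j, (μ j).eval ϖ * (∫ z in Set.pi Set.univ (fun _ : Fin (d j) => Set.Icc (0:ℝ) 1), G j (ϖ • z)))) → ∀ (N : ℕ) (hn : ∀ i, n i ≤ N) (hd : ∀ j, d j ≤ N) (ε : ℝ), 0 < ε → ∀ (K : ℕ) (c : Fin K → Fin N) (W : Set (Fin (N + 1) → ℝ)) (H : Fin K → (Fin (N + 1) → ℝ)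 → ℝ), (IsOpen W ∧ {w : Fin (N + 1) → ℝ | Fin.init w ∈ Literature.NumberTheory.Transcendental.KZ.cube N ∧ 0 ≤ w (Fin.last N) ∧ w (Fin.last N) ≤ max ε (ϖ₀ : ℝ)} ⊆ W ∧ (∀ k, Literature.NumberTheory.Transcendental.IsSemialgebraicFunOn ℚ W (H k) ∧ AnalyticOnNhd ℝ (H k) W) ∧ ∀ w ∈ Literature.NumberTheory.Transcendental.KZ.cube (N + 1), w (Fin.last N) ≤ ε → (m₀ : ℝ) + ∑ i, (m i : ℝ) * g i (w (Fin.last N) • (fun l : Fin (n i) => w (Fin.castSucc (Fin.castLE (hn i) l)))) - (w (Fin.last N) - (ϖ₀ : ℝ)) * (μ₀.eval (w (Fin.last N)) + ∑ j, (μ j).eval (w (Fin.last N)) * G j (w (Fin.last N) • (fun l : Fin (d j) => w (Fin.castSucc (Fin.castLE (hd j) l))))) = ∑ k, (fderiv ℝ (H k) w (Pi.single (Fin.castSucc (c k)) 1) - H k (Function.update w (Fin.castSucc (c k)) 1) + H k (Function.update w (Fin.castSucc (c k)) 0))) → ∃ (M K' : ℕ) (c' : Fin K' → Fin (N + M)) (W'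 : Set (Fin (N + M + 1) → ℝ)) (H' : Fin K' → (Fin (N + M + 1) → ℝ) → ℝ), IsOpen W' ∧ {w : Fin (N + M + 1) → ℝ | Fin.init w ∈ Literature.NumberTheory.Transcendental.KZ.cube (N + M) ∧ w (Fin.last (N + M)) = (ϖ₀ : ℝ)} ⊆ W' ∧ (∀ k, Literature.NumberTheory.Transcendental.IsSemialgebraicFunOn ℚ W' (H' k) ∧ AnalyticOnNhd ℝ (H' k) W') ∧ ∀ w : Fin (N + M + 1) → ℝ, Fin.init w ∈ Literature.NumberTheory.Transcendental.KZ.cube (N + M) → w (Fin.last (N + M)) = (ϖ₀ : ℝ) → (m₀ : ℝ) + ∑ i, (m i : ℝ) * g i ((ϖ₀ : ℝ) • (fun l : Fin (n i) => Fin.init w (Fin.castLE ((hn i).trans (Nat.le_add_right N M)) l))) = ∑ k, (fderiv ℝ (H' k) w (Pi.single (Fin.castSucc (c' k)) 1) - H' k (Function.update w (Fin.castSucc (c' k)) 1) + H' k (Function.update w (Fin.castSucc (c' k)) 0)) := by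
  intro S n g U hg m m₀ ϖ₀ hϖ0 hϖ1 T d G V μ μ₀ hG _hμ _hμ₀ _hrel N hn hd ε hε K c W H hWH
  obtain ⟨hWo, hWsub, hH, hgerm⟩ := hWH
  have hϖ0' : (0 : ℝ) < (ϖ₀ : ℝ) := by exact_mod_cast hϖ0
  have hϖ1' : (ϖ₀ : ℝ) ≤ 1 := by exact_mod_cast hϖ1
  -- the two sides of the germ identity as functions on `ℝ^{N+1}`
  obtain ⟨F, hF⟩ : ∃ F : (Fin (N + 1) → ℝ) → ℝ, ∀ w, F w = (m₀ : ℝ) + ∑ i, (m i : ℝ) *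
      g i (w (Fin.last N) • (fun l : Fin (n i) => w (Fin.castSucc (Fin.castLE (hn i) l)))) -
      (w (Fin.last N) - (ϖ₀ : ℝ)) * (μ₀.eval (w (Fin.last N)) + ∑ j, (μ j).eval (w (Fin.last N)) *
      G j (w (Fin.last N) • (fun l : Fin (d j) => w (Fin.castSucc (Fin.castLE (hd j) l))))) :=
    ⟨_, fun w => rfl⟩
  obtain ⟨R, hR⟩ : ∃ R : (Fin (N + 1) → ℝ) → ℝ, ∀ w, R w = ∑ k, (fderiv ℝ (H k) w
      (Pi.single (Fin.castSucc (c k)) 1) - H k (Function.update w (Fin.castSucc (c k)) 1) +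
      H k (Function.update w (Fin.castSucc (c k)) 0)) :=
    ⟨_, fun w => rfl⟩
  have hgerm' : ∀ w ∈ KZ.cube (N + 1), w (Fin.last N) ≤ ε → F w = R w := fun w hw hwe => by
    rw [hF, hR]; exact hgerm w hw hwe
  -- the slab `P = [0,1]^N × [0, ϖ₀]` as a product of intervals
  set u : Fin (N + 1) → ℝ := Function.update (fun _ => (1 : ℝ)) (Fin.last N) (ϖ₀ : ℝ) with hu
  have hu_last : u (Fin.last N) = ϖ₀ := by simp [hu]
  have hu_cs : ∀ i : Fin N, u (Fin.castSucc i) = 1 := fun i => by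
    simp [hu]
  have hu_le : ∀ i, u i ≤ 1 := fun i => by
    cases i using Fin.lastCases with
    | last => rw [hu_last]; exact hϖ1'
    | cast i => rw [hu_cs]
  set P : Set (Fin (N + 1) → ℝ) := Set.pi Set.univ (fun i => Set.Icc (0 : ℝ) (u i)) with hP
  have hmemP : ∀ {w : Fin (N + 1) → ℝ}, w ∈ P ↔ ∀ i, 0 ≤ w i ∧ w i ≤ u i := fun {w} =>
    Set.mem_univ_pi
  have hP01 : ∀ {w : Fin (N + 1) → ℝ}, w ∈ P → ∀ i, 0 ≤ w i ∧ w i ≤ 1 := fun hw i =>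
    ⟨(hmemP.1 hw i).1, (hmemP.1 hw i).2.trans (hu_le i)⟩
  have hPlast : ∀ {w : Fin (N + 1) → ℝ}, w ∈ P → 0 ≤ w (Fin.last N) ∧ w (Fin.last N) ≤ ϖ₀ :=
    fun hw => by have h := hmemP.1 hw (Fin.last N); rwa [hu_last] at h
  have hPinit : ∀ {w : Fin (N + 1) → ℝ}, w ∈ P → Fin.init w ∈ KZ.cube N := fun hw i =>
    hP01 hw (Fin.castSucc i)
  have hPW : P ⊆ W := fun w hw =>
    hWsub ⟨hPinit hw, (hPlast hw).1, (hPlast hw).2.trans (le_max_right _ _)⟩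
  have hPupd : ∀ {w : Fin (N + 1) → ℝ}, w ∈ P → ∀ (j : Fin N) {a : ℝ}, 0 ≤ a → a ≤ 1 →
      Function.update w (Fin.castSucc j) a ∈ P := by
    intro w hw j a ha0 ha1
    refine hmemP.2 fun i => ?_
    by_cases hij : i = Fin.castSucc j
    · subst hij
      rw [Function.update_self, hu_cs]
      exact ⟨ha0, ha1⟩
    · rw [Function.update_of_ne hij]
      exact hmemP.1 hw i
  have hsliceP : ∀ {w : Fin (N + 1) → ℝ}, Fin.init w ∈ KZ.cube N → w (Fin.last N) = ϖ₀ → w ∈ P :=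
    fun {w} hw hwl => hmemP.2 fun i => by
      cases i using Fin.lastCases with
      | last => rw [hwl, hu_last]; exact ⟨hϖ0'.le, le_rfl⟩
      | cast i => rw [hu_cs]; exact hw i
  -- on `P` the dilated arguments stay in the unit cubes `⊆ U i`, `⊆ V j`
  have hcubeU : ∀ i, ∀ {w : Fin (N + 1) → ℝ}, w ∈ P →
      (w (Fin.last N) • (fun l : Fin (n i) => w (Fin.castSucc (Fin.castLE (hn i) l)))) ∈ U i := by
    intro i w hw
    refine (hg i).2.1 (Set.mem_univ_pi.2 fun l => ?_)
    simp only [Pi.smul_apply, smul_eq_mul]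
    exact ⟨mul_nonneg (hPlast hw).1 (hP01 hw _).1,
      mul_le_one₀ ((hPlast hw).2.trans hϖ1') (hP01 hw _).1 (hP01 hw _).2⟩
  have hcubeV : ∀ j, ∀ {w : Fin (N + 1) → ℝ}, w ∈ P →
      (w (Fin.last N) • (fun l : Fin (d j) => w (Fin.castSucc (Fin.castLE (hd j) l)))) ∈ V j := by
    intro j w hw
    refine (hG j).2.1 (Set.mem_univ_pi.2 fun l => ?_)
    simp only [Pi.smul_apply, smul_eq_mul]
    exact ⟨mul_nonneg (hPlast hw).1 (hP01 hw _).1,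
      mul_le_one₀ ((hPlast hw).2.trans hϖ1') (hP01 hw _).1 (hP01 hw _).2⟩
  -- both sides are analytic at every point of `P`
  have hFa : AnalyticOnNhd ℝ F P := by
    intro w hw
    rw [show F = _ from funext hF]
    have hA : ∀ i, AnalyticAt ℝ (fun v : Fin (N + 1) → ℝ => (m i : ℝ) *
        g i (v (Fin.last N) • (fun l : Fin (n i) => v (Fin.castSucc (Fin.castLE (hn i) l))))) w :=
      fun i => analyticAt_const.fun_mul
        (((hg i).2.2.2 _ (hcubeU i hw)).fun_comp_of_eq (analyticAt_dilate (hn i) w) rfl)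
    have hB : ∀ j, AnalyticAt ℝ (fun v : Fin (N + 1) → ℝ => (μ j).eval (v (Fin.last N)) *
        G j (v (Fin.last N) • (fun l : Fin (d j) => v (Fin.castSucc (Fin.castLE (hd j) l))))) w :=
      fun j => (analyticAt_eval_last (μ j) w).fun_mul
        (((hG j).2.2.2 _ (hcubeV j hw)).fun_comp_of_eq (analyticAt_dilate (hd j) w) rfl)
    have hsumA := Finset.univ.analyticAt_fun_sum fun i _ => hA i
    have hsumB := Finset.univ.analyticAt_fun_sum fun j _ => hB j
    exact (analyticAt_const.fun_add hsumA).fun_sub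
      (((analyticAt_apply (Fin.last N) w).fun_sub analyticAt_const).fun_mul
        ((analyticAt_eval_last μ₀ w).fun_add hsumB))
  have hRa : AnalyticOnNhd ℝ R P := by
    intro w hw
    rw [show R = _ from funext hR]
    refine Finset.univ.analyticAt_fun_sum fun k _ => ?_
    have h1 : AnalyticAt ℝ (fun v : Fin (N + 1) → ℝ =>
        fderiv ℝ (H k) v (Pi.single (Fin.castSucc (c k)) 1)) w :=
      analyticAt_fderiv_apply ((hH k).2 w (hPW hw)) _
    have h2 : ∀ {a : ℝ}, 0 ≤ a → a ≤ 1 →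
        AnalyticAt ℝ (fun v : Fin (N + 1) → ℝ => H k (Function.update v (Fin.castSucc (c k)) a)) w :=
      fun {a} ha0 ha1 => ((hH k).2 _ (hPW (hPupd hw (c k) ha0 ha1))).fun_comp_of_eq
        (analyticAt_update (Fin.castSucc (c k)) a w) rfl
    exact (h1.fun_sub (h2 zero_le_one le_rfl)).fun_add (h2 le_rfl zero_le_one)
  -- the base point `p = (½,…,½, t₀)` and an open box around it inside the germ region
  set t₀ : ℝ := min ε (ϖ₀ : ℝ) / 2 with ht₀
  have ht₀pos : 0 < t₀ := div_pos (lt_min hε hϖ0') two_pos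
  have ht₀ε : t₀ < ε := by
    have h := min_le_left ε (ϖ₀ : ℝ)
    rw [ht₀]; linarith
  have ht₀ϖ : t₀ < ϖ₀ := by
    have h := min_le_right ε (ϖ₀ : ℝ)
    rw [ht₀]; linarith
  have ht₀1 : t₀ < 1 := ht₀ϖ.trans_le hϖ1'
  set p : Fin (N + 1) → ℝ := Function.update (fun _ => (2⁻¹ : ℝ)) (Fin.last N) t₀ with hp
  have hp_last : p (Fin.last N) = t₀ := by simp [hp]
  have hp_cs : ∀ i : Fin N, p (Fin.castSucc i) = 2⁻¹ := fun i => by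
    simp [hp]
  have hpP : p ∈ P := hmemP.2 fun i => by
    cases i using Fin.lastCases with
    | last => rw [hp_last, hu_last]; exact ⟨ht₀pos.le, ht₀ϖ.le⟩
    | cast i => rw [hp_cs, hu_cs]; norm_num
  set b : Fin (N + 1) → ℝ := Function.update (fun _ => (1 : ℝ)) (Fin.last N) (min ε 1) with hb
  have hb_last : b (Fin.last N) = min ε 1 := by simp [hb]
  have hb_cs : ∀ i : Fin N, b (Fin.castSucc i) = 1 := fun i => by
    simp [hb]
  have hb_le : ∀ i, b i ≤ 1 := fun i => by
    cases i using Fin.lastCases with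
    | last => rw [hb_last]; exact min_le_right _ _
    | cast i => rw [hb_cs]
  set O : Set (Fin (N + 1) → ℝ) := Set.pi Set.univ (fun i => Set.Ioo (0 : ℝ) (b i)) with hO
  have hOo : IsOpen O := isOpen_set_pi Set.finite_univ fun i _ => isOpen_Ioo
  have hpO : p ∈ O := Set.mem_univ_pi.2 fun i => by
    cases i using Fin.lastCases with
    | last => rw [hp_last, hb_last]; exact ⟨ht₀pos, lt_min ht₀ε ht₀1⟩
    | cast i => rw [hp_cs, hb_cs]; norm_num
  have hOgerm : Set.EqOn F R O := fun w hw => by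
    have hw' := Set.mem_univ_pi.1 hw
    refine hgerm' w (fun i => ⟨(hw' i).1.le, (hw' i).2.le.trans (hb_le i)⟩) ?_
    have h := (hw' (Fin.last N)).2
    rw [hb_last, lt_min_iff] at h
    exact h.1.le
  have hev : F =ᶠ[𝓝 p] R := Filter.eventuallyEq_of_mem (hOo.mem_nhds hpO) hOgerm
  -- identity theorem on the convex slab `P`
  have hPconn : IsPreconnected P :=
    (convex_pi (𝕜 := ℝ) fun i _ => convex_Icc (0 : ℝ) (u i)).isPreconnected
  have hEq : Set.EqOn F R P := hFa.eqOn_of_preconnected_of_eventuallyEq hRa hPconn hpP hev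
  -- conclusion with `M := 0`, `H' := H`, `c' := c`, `W' := W`
  refine ⟨0, K, c, W, H, hWo, ?_, hH, ?_⟩
  · rintro w ⟨hw, hwl⟩
    exact hPW (hsliceP hw hwl)
  · intro w hw hwl
    have key := hEq (hsliceP hw hwl)
    rw [hF, hR] at key
    have hwl' : w (Fin.last N) = ϖ₀ := hwl
    rw [hwl', sub_self, zero_mul, sub_zero] at key
    exact key

end Summit.KontsevichZagierPeriods.LiftingCriteria.DilationTransfer
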